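import Literature.Computability.ImplicitComplexity.SoftTypeAssignmentSubst
import HarnessLib

/-!
# Standardization for `Λ₊` (λ-calculus with erratic choice)

The untyped calculus `Λ₊` of `STA₊` (Gaboardi–Marion–Ronchi Della Rocca 2008 = GMR08, Def. 5.1–5.2:
terms `x | M N | λx.M | M + N`, reduction `→βγ` the contextual closure of `β`, `M + N →γ M`,
`M + N →γ N`) is not confluent, so "`N` is a normal form of `M`" means `M →βγ* N` with `N` normal,
by ANY reduction sequence (this is the acceptance condition of GMR08 Def. 5.13, the tree's
`STA.DecidesByZero`). The soundness theorem GMR08 Thm. 5.12 evaluates a typed term "to every one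
of its normal forms" with a leftmost-outermost machine (Lemma 5.4, Lemma 5.7); the combinatorial
fact underneath — every normal form reachable by some `βγ`-sequence is reachable by a STANDARD
one — is the standardization theorem, proved here for `Λ₊` following Kashima's inductive
presentation of standard reductions (R. Kashima, *A proof of the standardization theorem in
λ-calculus*, 2000; M. Takahashi, *Parallel reductions in λ-calculus*, 1995), extended by the two
choice rules (which behave as head rules):

* `STA.Hd` — weak head reduction with choice: `(λx.M) N A⃗ →ₕ M[N/x] A⃗`, `(M + N) A⃗ →ₕ M A⃗`,
  `(M + N) A⃗ →ₕ N A⃗`; `STA.HdStar` its reflexive–transitive closure.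
* `STA.St` — Kashima's standard reduction relation `M ⇛ N`: head-reduce, then freeze the head
  constructor and continue (standardly) inside the components.
* `St.of_reduces` — **standardization**: `M →βγ* N` implies `M ⇛ N`.

The leftmost-outermost strategy and its completeness for normal forms are in
`SoftTypeAssignmentLeftmost.lean`.

## References

* [GaboardiMarionRonchidellarocca2008] GMR08, Def. 5.2, §5.1 (Lemma 5.4, Lemma 5.7, Thm. 5.12).
* R. Kashima, *A proof of the standardization theorem in λ-calculus*, RIMS Kôkyûroku 1217 (2001).
* M. Takahashi, *Parallel reductions in λ-calculus*, Inform. and Comput. 118 (1995).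
-/

namespace Literature.Computability.ImplicitComplexity

namespace STA

/-! ### Weak head reduction with choice -/

/-- Weak head reduction of `Λ₊`: contract the head `β`-redex or resolve the head choice of an
application spine, `(λx.M) N A₁ ⋯ Aₖ →ₕ M[N/x] A₁ ⋯ Aₖ`, `(M + N) A⃗ →ₕ M A⃗`, `(M + N) A⃗ →ₕ N A⃗`
(the rules `(β)`, `(L)`, `(R)` of the machine `K_ND` of GMR08 Table 6, on plain terms).
[cite: GaboardiMarionRonchidellarocca2008, Def. 5.2 and §5.1 (Table 6)] -/
inductive Hd : Term → Term → Prop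
  | beta (M N : Term) : Hd (.app (.lam M) N) (M.subst0 N)
  | choiceL (M N : Term) : Hd (.sum M N) M
  | choiceR (M N : Term) : Hd (.sum M N) N
  | appL {M M' : Term} (N : Term) (h : Hd M M') : Hd (.app M N) (.app M' N)

/-- `→ₕ*`, finitely many weak head steps. [folklore] -/
def HdStar : Term → Term → Prop := Relation.ReflTransGen Hd

/-- A head step is a `→βγ` step. [cite: GaboardiMarionRonchidellarocca2008, Def. 5.2] -/
theorem Hd.red {M N : Term} (h : Hd M N) : Red M N := by
  induction h with
  | beta M N => exact Red.beta M N
  | choiceL M N => exact Red.choiceL M N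
  | choiceR M N => exact Red.choiceR M N
  | appL N _ ih => exact Red.appL N ih

/-- Head steps are stable under renaming. [folklore] -/
theorem Hd.rename {M N : Term} (h : Hd M N) (ρ : ℕ → ℕ) : Hd (M.rename ρ) (N.rename ρ) := by
  induction h with
  | beta M N =>
    rw [Term.subst0_rename]
    exact Hd.beta _ _
  | choiceL M N => exact Hd.choiceL _ _
  | choiceR M N => exact Hd.choiceR _ _
  | appL N _ ih => exact Hd.appL _ ih

/-- Head steps are stable under substitution. [folklore] -/
theorem Hd.substp {M N : Term} (h : Hd M N) (τ : ℕ → Term) : Hd (M.substp τ) (N.substp τ) := by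
  induction h with
  | beta M N =>
    rw [Term.subst0_substp]
    exact Hd.beta _ _
  | choiceL M N => exact Hd.choiceL _ _
  | choiceR M N => exact Hd.choiceR _ _
  | appL N _ ih => exact Hd.appL _ ih

namespace HdStar

/-- `→ₕ* ⊆ →βγ*`. [folklore] -/
theorem reduces {M N : Term} (h : HdStar M N) : Reduces M N := by
  induction h with
  | refl => exact Relation.ReflTransGen.refl
  | tail _ hst ih => exact ih.tail hst.red

/-- Head reduction of the function head-reduces the application. [folklore] -/
theorem appL {M M' : Term} (h : HdStar M M') (N : Term) : HdStar (.app M N) (.app M' N) := by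
  induction h with
  | refl => exact Relation.ReflTransGen.refl
  | tail _ hst ih => exact ih.tail (Hd.appL N hst)

/-- `→ₕ*` is stable under renaming. [folklore] -/
theorem rename {M N : Term} (h : HdStar M N) (ρ : ℕ → ℕ) : HdStar (M.rename ρ) (N.rename ρ) := by
  induction h with
  | refl => exact Relation.ReflTransGen.refl
  | tail _ hst ih => exact ih.tail (hst.rename ρ)

/-- `→ₕ*` is stable under substitution. [folklore] -/
theorem substp {M N : Term} (h : HdStar M N) (τ : ℕ → Term) : HdStar (M.substp τ) (N.substp τ) := by
  induction h with
  | refl => exact Relation.ReflTransGen.refl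
  | tail _ hst ih => exact ih.tail (hst.substp τ)

end HdStar

/-! ### Kashima's standard reductions -/

/-- Standard reduction `M ⇛ N` (Kashima): `M` head-reduces to a term whose outermost constructor
is then frozen, the components being reduced standardly in turn. For `Λ₊` a sum may either be
resolved by a head step or frozen with both branches reduced. [folklore] -/
inductive St : Term → Term → Prop
  | var {L : Term} (i : ℕ) (h : HdStar L (.var i)) : St L (.var i)
  | lam {L P Q : Term} (h : HdStar L (.lam P)) (hPQ : St P Q) : St L (.lam Q)
  | app {L P₁ P₂ Q₁ Q₂ : Term} (h : HdStar L (.app P₁ P₂)) (h₁ : St P₁ Q₁) (h₂ : St P₂ Q₂) :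
      St L (.app Q₁ Q₂)
  | sum {L P₁ P₂ Q₁ Q₂ : Term} (h : HdStar L (.sum P₁ P₂)) (h₁ : St P₁ Q₁) (h₂ : St P₂ Q₂) :
      St L (.sum Q₁ Q₂)

namespace St

/-- Standard reduction is reflexive. [folklore] -/
theorem refl (M : Term) : St M M := by
  induction M with
  | var i => exact St.var i Relation.ReflTransGen.refl
  | app M N ihM ihN => exact St.app Relation.ReflTransGen.refl ihM ihN
  | lam M ih => exact St.lam Relation.ReflTransGen.refl ih
  | sum M N ihM ihN => exact St.sum Relation.ReflTransGen.refl ihM ihN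

/-- Head steps may be prepended to a standard reduction. [folklore] -/
theorem hdStar_prepend {L M N : Term} (h : HdStar L M) (hMN : St M N) : St L N := by
  cases hMN with
  | var i h' => exact St.var i (h.trans h')
  | lam h' hPQ => exact St.lam (h.trans h') hPQ
  | app h' h₁ h₂ => exact St.app (h.trans h') h₁ h₂
  | sum h' h₁ h₂ => exact St.sum (h.trans h') h₁ h₂

/-- A standard reduction is a reduction. [folklore] -/
theorem reduces {M N : Term} (h : St M N) : Reduces M N := by
  induction h with
  | var i hL => exact hL.reduces
  | lam hL _ ih => exact hL.reduces.trans' (Reduces.lam ih)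
  | app hL _ _ ih₁ ih₂ => exact hL.reduces.trans' (Reduces.app ih₁ ih₂)
  | sum hL _ _ ih₁ ih₂ => exact hL.reduces.trans' (Reduces.sum ih₁ ih₂)

/-- Standard reductions are stable under renaming. [folklore] -/
theorem rename {M N : Term} (h : St M N) (ρ : ℕ → ℕ) : St (M.rename ρ) (N.rename ρ) := by
  induction h generalizing ρ with
  | var i hL => exact St.var (ρ i) (hL.rename ρ)
  | lam hL _ ih => exact St.lam (hL.rename ρ) (ih (liftRen ρ))
  | app hL _ _ ih₁ ih₂ => exact St.app (hL.rename ρ) (ih₁ ρ) (ih₂ ρ)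
  | sum hL _ _ ih₁ ih₂ => exact St.sum (hL.rename ρ) (ih₁ ρ) (ih₂ ρ)

/-- Standard reductions are stable under (pointwise standardly reducing) substitutions — the
substitution lemma of the standardization proof. [folklore] -/
theorem substp {M N : Term} (h : St M N) {σ σ' : ℕ → Term} (hσ : ∀ i, St (σ i) (σ' i)) :
    St (M.substp σ) (N.substp σ') := by
  induction h generalizing σ σ' with
  | var i hL => exact hdStar_prepend (hL.substp σ) (hσ i)
  | lam hL _ ih =>
    refine St.lam (hL.substp σ) (ih fun i => ?_)
    cases i with
    | zero => exact St.refl _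
    | succ i => exact (hσ i).rename Nat.succ
  | app hL _ _ ih₁ ih₂ => exact St.app (hL.substp σ) (ih₁ hσ) (ih₂ hσ)
  | sum hL _ _ ih₁ ih₂ => exact St.sum (hL.substp σ) (ih₁ hσ) (ih₂ hσ)

/-- Standard reductions are a congruence for `M[N/x]`. [folklore] -/
theorem subst0 {M M' N N' : Term} (hM : St M M') (hN : St N N') : St (M.subst0 N) (M'.subst0 N') := by
  refine hM.substp fun i => ?_
  cases i with
  | zero => exact hN
  | succ i => exact St.refl _

/-- **Kashima's key lemma**: a standard reduction followed by one `→βγ` step is again standard.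
[folklore] -/
theorem red_append {L N P : Term} (hst : St L N) (hr : Red N P) : St L P := by
  induction hr generalizing L with
  | beta Q R =>
    cases hst with
    | app hL h₁ h₂ =>
      cases h₁ with
      | lam hP hQ => exact hdStar_prepend ((hL.trans (hP.appL _)).tail (Hd.beta _ _)) (hQ.subst0 h₂)
  | choiceL Q R =>
    cases hst with
    | sum hL h₁ _ => exact hdStar_prepend (hL.tail (Hd.choiceL _ _)) h₁
  | choiceR Q R =>
    cases hst with
    | sum hL _ h₂ => exact hdStar_prepend (hL.tail (Hd.choiceR _ _)) h₂
  | appL R _ ih =>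
    cases hst with
    | app hL h₁ h₂ => exact St.app hL (ih h₁) h₂
  | appR Q _ ih =>
    cases hst with
    | app hL h₁ h₂ => exact St.app hL h₁ (ih h₂)
  | lam _ ih =>
    cases hst with
    | lam hL h₁ => exact St.lam hL (ih h₁)
  | sumL R _ ih =>
    cases hst with
    | sum hL h₁ h₂ => exact St.sum hL (ih h₁) h₂
  | sumR Q _ ih =>
    cases hst with
    | sum hL h₁ h₂ => exact St.sum hL h₁ (ih h₂)

/-- **Standardization for `Λ₊`**: every `βγ`-reduction sequence can be replaced by a standard
one with the same end points. [folklore] -/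
theorem of_reduces {M N : Term} (h : Reduces M N) : St M N := by
  induction h with
  | refl => exact St.refl M
  | tail _ hst ih => exact ih.red_append hst

end St

/-- `M →βγ* N` iff `M ⇛ N`: standard reductions are complete. [folklore] -/
theorem st_iff_reduces {M N : Term} : St M N ↔ Reduces M N :=
  ⟨St.reduces, St.of_reduces⟩

end STA

end Literature.Computability.ImplicitComplexity
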